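import Summits.HubbardSuperconductivity.HubbardSuperconductivity.Theorems.AnisotropyChordTransferFibre3KT2bStrip
import Summits.HubbardSuperconductivity.HubbardSuperconductivity.Theorems.AnisotropyChordTransferFibre3ManifoldBand

/-!
# Route `AnisotropyChord` / H0 rotor rung, PartN41-E §2: the MANIFOLD t-BAND `TBand` PROVED

Theory-1 g23's PartN41-E §2 (port `…Fibre3KT2bStrip`; director RULING D4′): for `L ≥ 128` and every ground two-magnon profile with
`0 ≤ Δ < 1`, `t·(1 − a) ≤ (0.00794 + 0.00226·ν)·η_eff` (`t = (2π/L)²`, `a = Δ f(x̂)`, `ν = λ₂/t`).  Proof: the lower manifold band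
`1 − 4η·gL⁺(L)·(1 + 1/L²) ≤ a`, `gL⁺ = ln L/2π + 0.0510 + 0.234ν` (`ManifoldA.manifold_band`, 3rd conjunct), times `t`, with
`t·ln L/(2π) = 2π·ln L/L² ≤ 2π·4.8521/16384` (`ManifoldA.log_div_sq_le`), `t ≤ 4π²/16384`, `1/L² ≤ 1/16384`, `π < 3.141593`
(`4t₀(1 + t₀/4π²)(ln 128/2π + .0510) = .0079351 ≤ .00794`, `× .234 = .0022555 ≤ .00226`).
★ `RowC.tBand_holds : N41E.TBand L`.  (The banded `Chi` row `TRbBand`/`ChiNT`/`Cs2LeChiNT` and its `RExpr` `min` slots are the next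
§2 items; this is the analytic input.)
Prover seat `hubbard-h0-rotor-p1` g29 (route lead); helper for piece A = stmt-HubbardSuperconductivity-23918 of rung 19089
(`--supports`, helper class).  Nothing here proves superconductivity in the Hubbard model; a family-A input of ONE conditional
reduction; the rotor TARGET as originally worded stays FALSE (g15 verdict).  Tree imports only; no sorry.
-/

set_option linter.dupNamespace false
set_option autoImplicit false

noncomputable section

namespace Summit.HubbardSuperconductivity.HubbardSuperconductivity.Theorems.AnisotropyChord.Transfer.Fibre3

namespace RowC

variable (L : ℕ) [NeZero L]

omit [NeZero L] in
/-- the numerical heart: for `L ≥ 128`, `0 ≤ ν`,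
`4·t·(ln L/2π + 0.0510 + 0.234ν)·(1 + 1/L²) ≤ 0.00794 + 0.00226ν`, `t = (2π/L)²`. [folklore] -/
theorem tBand_const_le (hL : 128 ≤ L) (ν : ℝ) (hν : 0 ≤ ν) :
    4 * (2 * Real.pi / L) ^ 2 * (Real.log L / (2 * Real.pi) + 0.0510 + 0.234 * ν) * (1 + 1 / (L : ℝ) ^ 2)
      ≤ 0.00794 + 0.00226 * ν := by
  have hπ0 := Real.pi_pos
  have hπ3 := Real.pi_gt_three
  have hπ := Real.pi_lt_d6
  have hLr : (128 : ℝ) ≤ L := by exact_mod_cast hL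
  have hL0 : (0 : ℝ) < L := by linarith
  have hV : (16384 : ℝ) ≤ (L : ℝ) ^ 2 := by nlinarith
  have hV0 : (0 : ℝ) < (L : ℝ) ^ 2 := by positivity
  -- the three inputs
  have hlog := ManifoldA.log_div_sq_le (L : ℝ) hLr
  have hlog0 : 0 ≤ Real.log (L : ℝ) := Real.log_nonneg (by linarith)
  have hiV : 1 / (L : ℝ) ^ 2 ≤ 1 / 16384 := div_le_div_of_nonneg_left (by norm_num) (by norm_num) hV
  have hiV0 : 0 ≤ 1 / (L : ℝ) ^ 2 := by positivity
  -- `t = 4π²·(1/L²)`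
  have ht : (2 * Real.pi / L) ^ 2 = 4 * Real.pi ^ 2 * (1 / (L : ℝ) ^ 2) := by field_simp; norm_num
  have ht0 : 0 ≤ (2 * Real.pi / L) ^ 2 := sq_nonneg _
  have htle : (2 * Real.pi / L) ^ 2 ≤ 4 * Real.pi ^ 2 * (1 / 16384) := by
    rw [ht]; exact mul_le_mul_of_nonneg_left hiV (by positivity)
  -- `t·ln L/(2π) = 2π·(ln L/L²) ≤ 2π·4.8521/16384`
  have h1 : (2 * Real.pi / L) ^ 2 * (Real.log L / (2 * Real.pi)) = 2 * Real.pi * (Real.log L / (L : ℝ) ^ 2) := by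
    field_simp
  have h1' : (2 * Real.pi / L) ^ 2 * (Real.log L / (2 * Real.pi)) ≤ 2 * Real.pi * (4.8521 / 16384) := by
    rw [h1]; exact mul_le_mul_of_nonneg_left hlog (by positivity)
  -- `t·(0.0510 + 0.234ν) ≤ (4π²/16384)(0.0510 + 0.234ν)`
  have h2 : (2 * Real.pi / L) ^ 2 * (0.0510 + 0.234 * ν) ≤ 4 * Real.pi ^ 2 * (1 / 16384) * (0.0510 + 0.234 * ν) :=
    mul_le_mul_of_nonneg_right htle (by positivity)
  -- assemble: `t·gL⁺ ≤ S := 2π·4.8521/16384 + (4π²/16384)(0.0510 + 0.234ν)`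
  set S : ℝ := 2 * Real.pi * (4.8521 / 16384) + 4 * Real.pi ^ 2 * (1 / 16384) * (0.0510 + 0.234 * ν) with hS
  have hS0 : 0 ≤ S := by positivity
  have hsum : (2 * Real.pi / L) ^ 2 * (Real.log L / (2 * Real.pi) + 0.0510 + 0.234 * ν) ≤ S := by
    have e : (2 * Real.pi / L) ^ 2 * (Real.log L / (2 * Real.pi) + 0.0510 + 0.234 * ν)
        = (2 * Real.pi / L) ^ 2 * (Real.log L / (2 * Real.pi)) + (2 * Real.pi / L) ^ 2 * (0.0510 + 0.234 * ν) := by ring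
    rw [e, hS]; exact add_le_add h1' h2
  have hfac : (1 + 1 / (L : ℝ) ^ 2) ≤ 1 + 1 / 16384 := by linarith
  have hmain : 4 * (2 * Real.pi / L) ^ 2 * (Real.log L / (2 * Real.pi) + 0.0510 + 0.234 * ν) * (1 + 1 / (L : ℝ) ^ 2)
      ≤ 4 * S * (1 + 1 / 16384) := by
    have hg0 : 0 ≤ (2 * Real.pi / L) ^ 2 * (Real.log L / (2 * Real.pi) + 0.0510 + 0.234 * ν) := by positivity
    have := mul_le_mul (mul_le_mul_of_nonneg_left hsum (by norm_num : (0:ℝ) ≤ 4)) hfac (by positivity) (by positivity)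
    simpa [mul_assoc] using this
  -- numerics: `π < 3.141593`, `π² < 9.8697`
  have hπ2 : Real.pi ^ 2 < 9.8697 := by nlinarith
  have hν2 : Real.pi ^ 2 * ν ≤ 9.8697 * ν := mul_le_mul_of_nonneg_right hπ2.le hν
  have hSle : 4 * S * (1 + 1 / 16384) ≤ 0.00794 + 0.00226 * ν := by
    rw [hS]; nlinarith
  exact hmain.trans hSle

/-- ★ **`TBand L` holds** (PartN41-E §2): `t·(1 − a) ≤ (0.00794 + 0.00226ν)·η_eff` for `L ≥ 128` and every ground profile. [folklore] -/
theorem tBand_holds : N41E.TBand L := by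
  intro hL Δ lam2 f hΔ0 hΔ1 hf
  obtain ⟨_, _, h3, _⟩ := ManifoldA.manifold_band L hL hΔ0 hΔ1 hf
  have hpos := lam2_pos L (by omega) hΔ1 hf.1
  have hη0 : 0 ≤ etaEff L lam2 := by unfold etaEff; positivity
  have ht0 : 0 ≤ (2 * Real.pi / L) ^ 2 := sq_nonneg _
  have hν0 : 0 ≤ lam2 / (2 * Real.pi / L) ^ 2 := by positivity
  have hc := tBand_const_le L hL (lam2 / (2 * Real.pi / L) ^ 2) hν0
  set gp : ℝ := Real.log L / (2 * Real.pi) + 0.0510 + 0.234 * (lam2 / (2 * Real.pi / L) ^ 2) with hgp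
  -- `1 − a ≤ 4 η gp (1 + 1/V)`
  have h1a : 1 - Δ * f (K1 L) ≤ 4 * etaEff L lam2 * gp * (1 + 1 / (L : ℝ) ^ 2) := by linarith
  unfold N41E.TBandConst
  calc (2 * Real.pi / L) ^ 2 * (1 - Δ * f (K1 L))
      ≤ (2 * Real.pi / L) ^ 2 * (4 * etaEff L lam2 * gp * (1 + 1 / (L : ℝ) ^ 2)) := mul_le_mul_of_nonneg_left h1a ht0
    _ = (4 * (2 * Real.pi / L) ^ 2 * gp * (1 + 1 / (L : ℝ) ^ 2)) * etaEff L lam2 := by ring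
    _ ≤ (0.00794 + 0.00226 * (lam2 / (2 * Real.pi / L) ^ 2)) * etaEff L lam2 := mul_le_mul_of_nonneg_right hc hη0

end RowC

end Summit.HubbardSuperconductivity.HubbardSuperconductivity.Theorems.AnisotropyChord.Transfer.Fibre3

end
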